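import Summits.BirchSwinnertonDyer.Rank1Residual.X11a.SelmerCompanionKindsAtP
import Summits.BirchSwinnertonDyer.Rank1Residual.X11a.SelmerCompanionNonsplitPartner
import HarnessLib

/-!
# Route (3e) SELMER COMPANION, XII: the count over `ℚ` with SIX kinds of places, and the general
# booking shape (class X11a = N7; cell `b2b-bsdres`, unit `b2b-bsdres-x11a`, gen 28)

HONEST FRAMING (run/shared/lean/b2b/bsd-rank1-residual/, verbatim in every file): the goal of the
cell is to DELETE the COMBINATION-SHAPED residual classes of the Birch–Swinnerton-Dyer formula for
ALL analytic-rank `≤ 1` elliptic curves over `ℚ` — "full BSD formula for every rank `≤ 1` curve in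
class `C`" assembled STRICTLY from published theorems — so that the rank-`≤ 1` remainder becomes
exactly the CONSTRUCTION-SHAPED classes, which are TYPED (missing-input `Prop`s), NOT attempted.
This is not "finishing BSD". CLASS-OWNERS.md: research routes; NO CLAIM BEYOND STATED CLASSES.
THEOREMS ONLY; nothing booked; no label moves. CONDITIONAL on the PUBLISHED binders GZK (`hGZK`),
Cassels–Tate (`hCT`), Tate uniformisation (`hU` = A40, `hU2` = A41) and Tate's local Euler
characteristic (`hEP`, Milne *ADT* I Thm. 2.8), and on the per-pair finite data named.

`natCard_selmerGroup_le_of_congr_of_six_kinds_rat`: file IX's count over `ℚ` with a SIXTH kind of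
place where the local conditions agree along `θ : E[p] ≃ A[p]`: (vi) the place of an odd prime
`ℓ ≠ p` at which `E` has GOOD reduction and the globally minimal partner `A` is NON-SPLIT
multiplicative (`γ(A)` not a square in `ℚ_ℓ`) — file XI-b
(`h1Equiv_mem_selmerLocalKer_of_good_of_nonsplit_rat`): a level-raised partner costs nothing at a
non-split level-raising prime (at a SPLIT one it costs `ι_ℓ = p`, sharp).
`bsdp_of_bsdp_partner_of_selmerCompanion_six_kinds`: the GENERAL BOOKING SHAPE of route (3e) —
`BSD(A,p) ⟹ BSD(E,p)` at a rank-`0` pair `(E,p)` (`p` odd, `E[p]` irreducible, `p ∤ #Ш_an(E)`) from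
a closed partner `A` (`BSD(A,p)`, `p ∤ #Ш_an(A)`, any analytic rank) along a `Γ_ℚ`-isomorphism
`A[p] ≅ E[p]`, a finite set `S` of places outside which both curves are good and `v ∤ p`, a lossy
subset `T ⊆ S` (which MAY contain the place of `p`), every place of `S \ T` of one of the six kinds,
and the budget `p^{r_an(A)} · ∏_{v ∈ T} #E(ℚ_v)[p] · #(ℤ_v/p) ≤ p`. Shapes A (file III/V), C (file
IX) are the cases `T ∋ p` with kinds (i)–(iv) away from `p`, resp. `T ∌ p` with kind (v) at `p`.
Census of this gen: `HOME/b2b-bsdres-x11a/g28/SELMER-COMPANION-CENSUS-v4.md`.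

References: files I–XI; [MazurRubin2004] §2.3; [GreenbergLNM1716] §2; [MilneADT2006] I Thm. 2.8,
Prop. 3.8; [SilvermanATAEC1994] V 5.2–5.4, Ex. 5.11; [Miller2011LMS] Def. 1.1;
HOME/b2b-bsdres-x11a/REPORT-g28.md.
-/

set_option autoImplicit false

noncomputable section

open scoped Classical NNReal

open WeierstrassCurve Literature.NumberTheory.EllipticCurves
  Literature.NumberTheory.GaloisRepresentations Field NumberField IsDedekindDomain
  Literature.NumberTheory.EllipticCurves.Rank1Residual
  Literature.NumberTheory.EllipticCurves.Rank1Residual.Typed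

namespace Summit.BirchSwinnertonDyer.Rank1Residual.X11a.SelmerCompanion

section Rat

variable (W A : WeierstrassCurve ℚ) [W.IsElliptic] [W.IsGloballyMinimal] [A.IsElliptic]
  [A.IsGloballyMinimal] (p : ℕ) [hp : Fact p.Prime]

/-- **The count over `ℚ` with SIX kinds of places**: for `θ : E[p] ≃ A[p]` (`E = W`, `A` globally
minimal), `p` odd, `T ⊆ S` as in file I, and every `v ∈ S \ T` of kind (i) `v ∤ p ∧ E(ℚ_v)[p] = 0`,
(ii) both split multiplicative with `#A(ℚ_v)[p] ≤ p`, (iii) both multiplicative of the same twist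
type with `μ_p(ℚ_v) = 1`, (iv) `v` the place of an odd prime `ℓ ≠ p` with `E` non-split
multiplicative and `A` good at `ℓ`, (v) `v` the place of `p`, `E` non-split multiplicative and `A`
good at `p` (needs `hEP`), or (vi) `v` the place of an odd prime `ℓ ≠ p` with `E` GOOD and `A`
NON-SPLIT multiplicative at `ℓ` (file XI-b):
`#Sel^(p)(E/ℚ) ≤ #Sel^(p)(A/ℚ) · ∏_{v ∈ T} #E(ℚ_v)[p] · #(ℤ_v/p)`.
[cite: MazurRubin2004, §2.3] [cite: SilvermanATAEC1994, Ch. V Thm. 3.1, Lemma 5.2, Thm. 5.3, Cor. 5.4, Ex. 5.11]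
[cite: GreenbergLNM1716, §2 Props. 2.2, 2.4] [cite: MilneADT2006, Ch. I §2 Thm. 2.8, Prop. 3.8] -/
theorem natCard_selmerGroup_le_of_congr_of_six_kinds_rat
    (hU : Silverman1994_thmV53_tateUniformisation.{0})
    (hU2 : Silverman1994_thmV53_corV54_tateUniformisation.{0})
    (hEP : ∀ v : HeightOneSpectrum (𝓞 ℚ), (p : 𝓞 ℚ) ∈ v.asIdeal →
      localEulerPoincareCharacteristic (v.adicCompletion ℚ)) (hp2 : p ≠ 2)
    (θ : geomTorsion W (p : ℤ) ≃+ geomTorsion A (p : ℤ))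
    (hθ : ∀ (σ : absoluteGaloisGroup ℚ) (P : geomTorsion W (p : ℤ)), θ (σ • P) = σ • θ P)
    (S T : Finset (HeightOneSpectrum (𝓞 ℚ))) (hTS : T ⊆ S)
    (hS : ∀ v : HeightOneSpectrum (𝓞 ℚ), v ∉ S →
      A.HasGoodReductionAt v ∧ W.HasGoodReductionAt v ∧ (p : 𝓞 ℚ) ∉ v.asIdeal)
    (hplaces : ∀ v ∈ S, v ∉ T →
      ((p : 𝓞 ℚ) ∉ v.asIdeal ∧ Nat.card (nsmulAddMonoidHom p :
          (W.baseChange (v.adicCompletion ℚ)).toAffine.Point →+ _).ker = 1) ∨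
      (A.HasSplitMultiplicativeReductionAt v ∧ W.HasSplitMultiplicativeReductionAt v ∧
        Nat.card (nsmulAddMonoidHom p :
          (A.baseChange (v.adicCompletion ℚ)).toAffine.Point →+ _).ker ≤ p) ∨
      (A.HasMultiplicativeReductionAt v ∧ W.HasMultiplicativeReductionAt v ∧
        (∃ r : v.adicCompletion ℚ, algebraMap ℚ (v.adicCompletion ℚ) (-(A.c₄ / A.c₆)) =
          r ^ 2 * algebraMap ℚ (v.adicCompletion ℚ) (-(W.c₄ / W.c₆))) ∧
        (∀ ζ : v.adicCompletion ℚ, ζ ^ p = 1 → ζ = 1)) ∨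
      (∃ (ℓ : ℕ) (_ : Fact ℓ.Prime), ℓ ≠ 2 ∧ (ℓ : 𝓞 ℚ) ∈ v.asIdeal ∧ (p : 𝓞 ℚ) ∉ v.asIdeal ∧
        W.HasMultiplicativeReductionAtPrime ℓ ∧
        (∀ r : v.adicCompletion ℚ, algebraMap ℚ (v.adicCompletion ℚ) (-(W.c₄ / W.c₆)) ≠ r ^ 2) ∧
        A.HasGoodReductionAt v) ∨
      ((p : 𝓞 ℚ) ∈ v.asIdeal ∧ W.HasMultiplicativeReductionAtPrime p ∧
        (∀ r : v.adicCompletion ℚ, algebraMap ℚ (v.adicCompletion ℚ) (-(W.c₄ / W.c₆)) ≠ r ^ 2) ∧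
        A.HasGoodReductionAtPrime p) ∨
      (∃ (ℓ : ℕ) (_ : Fact ℓ.Prime), ℓ ≠ 2 ∧ (ℓ : 𝓞 ℚ) ∈ v.asIdeal ∧ (p : 𝓞 ℚ) ∉ v.asIdeal ∧
        W.HasGoodReductionAt v ∧ A.HasMultiplicativeReductionAtPrime ℓ ∧
        (∀ r : v.adicCompletion ℚ, algebraMap ℚ (v.adicCompletion ℚ) (-(A.c₄ / A.c₆)) ≠ r ^ 2))) :
    Nat.card (W.selmerGroup (p : ℤ)) ≤
      Nat.card (A.selmerGroup (p : ℤ)) *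
        ∏ v ∈ T, (Nat.card (nsmulAddMonoidHom p :
            (W.baseChange (v.adicCompletion ℚ)).toAffine.Point →+ _).ker *
          Nat.card (v.adicCompletionIntegers ℚ ⧸
            Ideal.span {(p : v.adicCompletionIntegers ℚ)})) := by
  have hpp : p.Prime := hp.out
  classical
  -- enlarge `T` by the places of kind (i)
  set T' := T ∪ S.filter (fun v ↦ (p : 𝓞 ℚ) ∉ v.asIdeal ∧ Nat.card (nsmulAddMonoidHom p :
      (W.baseChange (v.adicCompletion ℚ)).toAffine.Point →+ _).ker = 1) with hT'
  have hT'S : T' ⊆ S := Finset.union_subset hTS (Finset.filter_subset _ _)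
  have h1 := natCard_selmerGroup_le_of_congr_of_le_off A W hp2 θ hθ S T' hT'S hS
    (fun v hv hvT c hc ↦ ?_)
  · refine h1.trans (Nat.mul_le_mul_left _ (le_of_eq ?_))
    have hsplit : T' = T ∪ (S.filter (fun v ↦ (p : 𝓞 ℚ) ∉ v.asIdeal ∧ Nat.card (nsmulAddMonoidHom p :
      (W.baseChange (v.adicCompletion ℚ)).toAffine.Point →+ _).ker = 1) \ T) := by
      rw [hT', Finset.union_sdiff_self_eq_union]
    rw [hsplit, Finset.prod_union Finset.disjoint_sdiff,
      Finset.prod_eq_one (s := _ \ T) (fun v hv ↦ ?_), mul_one]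
    · refine Finset.prod_congr rfl fun v _ ↦ ?_
      exact W.natCard_kummerLocalConditionAt_adicCompletion v hpp.ne_zero
    · rw [Finset.mem_sdiff, Finset.mem_filter] at hv
      rw [W.natCard_kummerLocalConditionAt_adicCompletion v hpp.ne_zero, hv.1.2.2, one_mul,
        natCard_quot_adicCompletionIntegers_eq_one hv.1.2.1]
  · have hvT0 : v ∉ T := fun h ↦ hvT (Finset.mem_union_left _ h)
    have hnot1 : ¬ ((p : 𝓞 ℚ) ∉ v.asIdeal ∧ Nat.card (nsmulAddMonoidHom p :
        (W.baseChange (v.adicCompletion ℚ)).toAffine.Point →+ _).ker = 1) := fun h ↦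
      hvT (Finset.mem_union_right _ (Finset.mem_filter.mpr ⟨hv, h⟩))
    rcases hplaces v hv hvT0 with h1 | ⟨hWv, hW'v, hcard⟩ | ⟨hWv, hW'v, hγ', hμ⟩ |
        ⟨ℓ, hℓ, hℓ2, hℓv, hpv, hmult, hγ', hAv⟩ | ⟨hpv, hmult, hγ', hAv⟩ |
        ⟨ℓ, hℓ, hℓ2, hℓv, hpv, hWv, hmultA, hγA⟩
    · exact absurd h1 hnot1
    · exact A.h1Equiv_mem_selmerLocalKer_of_hasSplitMultiplicativeReductionAt v hU W θ hθ hWv hW'v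
        hcard hc
    · exact A.h1Equiv_mem_selmerLocalKer_of_hasMultiplicativeReductionAt v hU2 hp2 W θ hθ hWv hW'v
        hγ' hμ hc
    · haveI := hℓ
      exact h1Equiv_mem_selmerLocalKer_of_nonsplit_of_good_rat W A p hU2 hp2 θ hθ hℓ2 hℓv hmult hγ'
        hAv hpv hc
    · exact h1Equiv_mem_selmerLocalKer_of_nonsplit_of_good_at_p W A p hU2 hp2 θ hθ hpv (hEP v hpv)
        hmult hγ' hAv hc
    · haveI := hℓ
      exact h1Equiv_mem_selmerLocalKer_of_good_of_nonsplit_rat W A p hU2 hp2 θ hθ hℓ2 hℓv hWv hmultA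
        hγA hpv hc

/-- **The general booking shape of route (3e) over `ℚ`: `BSD(A,p) ⟹ BSD(E,p)`.** Let `p` be an odd
prime, `E = W` globally minimal of analytic rank `0` with `E[p]` irreducible and `p ∤ #Ш_an(E)`,
`A` a globally minimal CLOSED partner (`BSD(A,p)` known, `p ∤ #Ш_an(A)`, any analytic rank) with a
`Γ_ℚ`-isomorphism `e : A[p] ≅ E[p]` (certificate C1), `S` a finite set of places outside which both
curves are good and `v ∤ p`, `T ⊆ S` the lossy places (the place of `p` MAY belong to `T`), every
place of `S \ T` of one of the six kinds of `natCard_selmerGroup_le_of_congr_of_six_kinds_rat`, and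
the budget `p^{r_an(A)} · ∏_{v ∈ T} #E(ℚ_v)[p] · #(ℤ_v/p) ≤ p`. Then `BSD(E,p)`: the count gives
`#Sel^(p)(E/ℚ) ≤ #Sel^(p)(A/ℚ) · ∏_T … = p^{r_an(A)} · ∏_T … ≤ p` (`natCard_selmerGroup_eq_pow_of_bsdp`),
and Cassels–Tate parity makes `Sel^(p)(E/ℚ) = 0`, so `Ш(E)[p] = 0` and `BSD(E,p)`
(`bsdp_of_natCard_selmerGroup_le`). Shapes A/B/C of files III, V, IX are special cases. Binders
GZK, Cassels–Tate, A40/A41, Tate's Euler characteristic; NO main conjecture, NO `μ`. Not a class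
theorem; nothing booked. [cite: MazurRubin2004, §2.3] [cite: Miller2011LMS, §1 and Def. 1.1]
[cite: GreenbergLNM1716, §2 Props. 2.2, 2.4] [cite: MilneADT2006, Ch. I §2 Thm. 2.8, Prop. 3.8]
[cite: SilvermanATAEC1994, Ch. V Thm. 3.1, Lemma 5.2, Thm. 5.3, Cor. 5.4, Ex. 5.11] -/
theorem bsdp_of_bsdp_partner_of_selmerCompanion_six_kinds
    (hU : Silverman1994_thmV53_tateUniformisation.{0})
    (hU2 : Silverman1994_thmV53_corV54_tateUniformisation.{0})
    (hEP : ∀ v : HeightOneSpectrum (𝓞 ℚ), (p : 𝓞 ℚ) ∈ v.asIdeal →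
      localEulerPoincareCharacteristic (v.adicCompletion ℚ))
    (hGZK : rank_eq_analyticRank_of_analyticRank_le_one)
    (hCT : exists_casselsTate_pairing (K := ℚ)) (hp2 : p ≠ 2)
    (hr : W.analyticRank = 0) (hirr : Irr W p) (hSha : X11a.ShaAnUnit W p)
    (hbsdA : BSDp A p) (hShaA : X11a.ShaAnUnit A p)
    (e : geomTorsion A (p : ℤ) ≃+ geomTorsion W (p : ℤ))
    (he : ∀ (σ : absoluteGaloisGroup ℚ) (P : geomTorsion A (p : ℤ)), e (σ • P) = σ • e P)
    (S T : Finset (HeightOneSpectrum (𝓞 ℚ))) (hTS : T ⊆ S)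
    (hS : ∀ v : HeightOneSpectrum (𝓞 ℚ), v ∉ S →
      A.HasGoodReductionAt v ∧ W.HasGoodReductionAt v ∧ (p : 𝓞 ℚ) ∉ v.asIdeal)
    (hplaces : ∀ v ∈ S, v ∉ T →
      ((p : 𝓞 ℚ) ∉ v.asIdeal ∧ Nat.card (nsmulAddMonoidHom p :
          (W.baseChange (v.adicCompletion ℚ)).toAffine.Point →+ _).ker = 1) ∨
      (A.HasSplitMultiplicativeReductionAt v ∧ W.HasSplitMultiplicativeReductionAt v ∧
        Nat.card (nsmulAddMonoidHom p :
          (A.baseChange (v.adicCompletion ℚ)).toAffine.Point →+ _).ker ≤ p) ∨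
      (A.HasMultiplicativeReductionAt v ∧ W.HasMultiplicativeReductionAt v ∧
        (∃ r : v.adicCompletion ℚ, algebraMap ℚ (v.adicCompletion ℚ) (-(A.c₄ / A.c₆)) =
          r ^ 2 * algebraMap ℚ (v.adicCompletion ℚ) (-(W.c₄ / W.c₆))) ∧
        (∀ ζ : v.adicCompletion ℚ, ζ ^ p = 1 → ζ = 1)) ∨
      (∃ (ℓ : ℕ) (_ : Fact ℓ.Prime), ℓ ≠ 2 ∧ (ℓ : 𝓞 ℚ) ∈ v.asIdeal ∧ (p : 𝓞 ℚ) ∉ v.asIdeal ∧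
        W.HasMultiplicativeReductionAtPrime ℓ ∧
        (∀ r : v.adicCompletion ℚ, algebraMap ℚ (v.adicCompletion ℚ) (-(W.c₄ / W.c₆)) ≠ r ^ 2) ∧
        A.HasGoodReductionAt v) ∨
      ((p : 𝓞 ℚ) ∈ v.asIdeal ∧ W.HasMultiplicativeReductionAtPrime p ∧
        (∀ r : v.adicCompletion ℚ, algebraMap ℚ (v.adicCompletion ℚ) (-(W.c₄ / W.c₆)) ≠ r ^ 2) ∧
        A.HasGoodReductionAtPrime p) ∨
      (∃ (ℓ : ℕ) (_ : Fact ℓ.Prime), ℓ ≠ 2 ∧ (ℓ : 𝓞 ℚ) ∈ v.asIdeal ∧ (p : 𝓞 ℚ) ∉ v.asIdeal ∧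
        W.HasGoodReductionAt v ∧ A.HasMultiplicativeReductionAtPrime ℓ ∧
        (∀ r : v.adicCompletion ℚ, algebraMap ℚ (v.adicCompletion ℚ) (-(A.c₄ / A.c₆)) ≠ r ^ 2)))
    (hbudget : p ^ A.analyticRank * ∏ v ∈ T, (Nat.card (nsmulAddMonoidHom p :
        (W.baseChange (v.adicCompletion ℚ)).toAffine.Point →+ _).ker *
          Nat.card (v.adicCompletionIntegers ℚ ⧸
            Ideal.span {(p : v.adicCompletionIntegers ℚ)})) ≤ p) :
    BSDp W p := by
  -- irreducibility of `A[p]`, the partner's count, and the transport along `θ = e⁻¹`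
  have hθ : ∀ (σ : absoluteGaloisGroup ℚ) (Q : geomTorsion W (p : ℤ)),
      e.symm (σ • Q) = σ • e.symm Q := fun σ Q ↦ by
    apply e.injective
    rw [e.apply_symm_apply, he, e.apply_symm_apply]
  have hirrA : Irr A p := GreenbergVatsal2000.hasIrreducibleModPGaloisRep_of_torsionIso e.symm hθ hirr
  have hSelA := natCard_selmerGroup_eq_pow_of_bsdp A p hbsdA hShaA hirrA
  have hle := natCard_selmerGroup_le_of_congr_of_six_kinds_rat W A p hU hU2 hEP hp2 e.symm hθ S T
    hTS hS hplaces
  refine bsdp_of_natCard_selmerGroup_le W p hGZK hCT hr hirr hSha (hle.trans ?_)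
  rw [hSelA]
  exact hbudget

end Rat

end Summit.BirchSwinnertonDyer.Rank1Residual.X11a.SelmerCompanion

end
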